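import Summits.BirchSwinnertonDyer.BirchSwinnertonDyer.Theses.ErratumRoadFive
import Summits.BirchSwinnertonDyer.BirchSwinnertonDyer.Theorems.ErratumRoadFiveJSWControlMultHolds
import HarnessLib

set_option linter.dupNamespace false -- `…BirchSwinnertonDyer.BirchSwinnertonDyer…` is the nested layout (D-0017)
set_option autoImplicit false

/-!
# Route `ErratumRoadFive`, item 19626 `JSWAnticyclotomicControlMult` (Jetchev–Skinner–Wan 2017 Thm. 3.3.1 at a multiplicative prime,
# by-name alias of `JetchevSkinnerWan2017.thm331_anticyclotomicControl_mult`) — PROVED BY NAME, unconditional AS TYPED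
# (LADDER-BSD D-0154 (2) INPUTS; desk `pub/bsd-wall/bsd-inputs`; cell `bsd-stepL`)

Seat `bsd-inputs-honda-p1` (gen 8, idle INPUTS prover), `--workitem stmt-BirchSwinnertonDyer-19626`. THEOREMS ONLY (no definition, no
named fact, no `sorry`); no new mathematics — a one-line `exact`. This module imports the route file, so it states the route
declaration itself; the ROUTE-FREE hypothesis-free form of the named fact, which it uses, is
`JSWControl.thm331_anticyclotomicControl_mult_holds` (`Theorems/ErratumRoadFiveJSWControlMultHolds.lean`, this seat, p635428).

The chain (all landed): `bsd-stepL-imc-p1` g16 proved `JSWControl.thm331_anticyclotomicControl_mult_of_poitouTate (hPT : ∀ K,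
poitouTate_selmerStructure_duality K) (hPT2 : ∀ K, poitouTate_sha_tateDual K) : JetchevSkinnerWan2017.thm331_anticyclotomicControl_mult`
(p596255: the tree's kernel control theorem re-assembled on JSW's own hypotheses, conditional ONLY on the two Poitou–Tate inputs; its
by-name twin `jswAnticyclotomicControlMult_of_poitouTate`, p596606). Both inputs are, since 2026-08-28, THEOREMS for every number field `K`:
`SchneiderFreeAdditiveX3.PoitouTateReduction.poitouTate_selmerStructure_duality_holds K` (Milne ADT I 4.10 (b); `bsd-schneider`,
p624636) and `SignedEC.PoitouTateShaRat.poitouTate_sha_tateDual_numberField K` (Milne ADT I 4.10 (a); `bsd-wall` K4, p629917).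
Hence the named fact holds with no hypothesis (`thm331_anticyclotomicControl_mult_holds`, p635428) and the route declaration carrying
item 19626 — a `def … : Prop :=` alias of it — follows by `exact` (§1).

Honest framing: JSW 2017 Thm. 3.3.1 is a published theorem; what is proved is the tree's TYPED statement (anticyclotomic control
identity at a multiplicative `p ≥ 3`, `K` imaginary quadratic with `p` split, `rank E(K) = 1`, `#Ш(E/K)[p^∞] < ∞`, any `ι` inducing the
strict prime), UNCONDITIONAL AS TYPED now that both Poitou–Tate inputs are kernel theorems. Item 19626 is an `aside` of `ErratumRoadFive`
(DROP-JSW, rev 42): closing it removes one displayed published input and moves NO crux; it is NOT a case of BSD; no summit statement is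
proved; the Birch–Swinnerton-Dyer conjecture is NOT proved by any of this.
References: [JetchevSkinnerWan2017] Thm. 3.3.1 (arXiv:1512.06894 Thm. 8, p. 11), §3.5 (3.5.c) (p. 15); [MilneADT2006] Ch. I,
Thm. 4.10 (a)(b).
-/

noncomputable section

namespace Summit.BirchSwinnertonDyer.BirchSwinnertonDyer.Theorems.JSWControl

open Literature.NumberTheory.GaloisCohomology Literature.NumberTheory.EllipticCurves

/-! ## §1 Item 19626 on its route, by name -/

/-- **Route `ErratumRoadFive`, aside `JSWAnticyclotomicControlMult` (item 19626) — PROVED (by name).** The route declaration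
`Summit.BirchSwinnertonDyer.BirchSwinnertonDyer.Theses.ErratumRoadFive.JSWAnticyclotomicControlMult`
(`:= JetchevSkinnerWan2017.thm331_anticyclotomicControl_mult`) by `exact thm331_anticyclotomicControl_mult_holds` (p635428 =
`thm331_anticyclotomicControl_mult_of_poitouTate` at the tree theorems
`SchneiderFreeAdditiveX3.PoitouTateReduction.poitouTate_selmerStructure_duality_holds` (PT 4.10 (b), every number field) and
`SignedEC.PoitouTateShaRat.poitouTate_sha_tateDual_numberField` (PT 4.10 (a), every number field)). Unconditional AS TYPED; closes item
19626; moves no crux; BSD is not proved by this.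
[cite: JetchevSkinnerWan2017, Thm. 3.3.1 (arXiv:1512.06894 Thm. 8, p. 11) with §3.5 (3.5.c) (p. 15)]
[cite: MilneADT2006, Ch. I, Thm. 4.10 (a)(b)] -/
theorem erratumRoadFive_jswAnticyclotomicControlMult_proof :
    Summit.BirchSwinnertonDyer.BirchSwinnertonDyer.Theses.ErratumRoadFive.JSWAnticyclotomicControlMult := by
  unfold Summit.BirchSwinnertonDyer.BirchSwinnertonDyer.Theses.ErratumRoadFive.JSWAnticyclotomicControlMult
  exact thm331_anticyclotomicControl_mult_holds

end Summit.BirchSwinnertonDyer.BirchSwinnertonDyer.Theorems.JSWControl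

end
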